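/- Copyright: the b2b-balaban cell (near-miss cell 7), T⁴-continuum fan-out, lineage t4-ne7b-p1 (node U5c COUNT
member).  Released under the licence of the surrounding project. -/
import Summits.QuantumFields.BalabanUV.T4Continuum.Support.HistoryGenealogyJunction
import Summits.QuantumFields.BalabanUV.T4Continuum.Support.HistoryRealiseWeakCells

/-!
# THE JUNCTION, PACKAGED (M4, brick 4): a TERM-INDEXED FAMILY of inputs to print's process with a common flow yields
the END's memory-agnostic domain carrier `RealisedDomainsRW` (owner module of row NE7b, lineage `t4-ne7b-p1` gen 41;
re-open object (α), `SCOPE-alpha.md` v2.3 §5 row M4 — PRE-POSITIONING ONLY)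

Summits-side support leaf of the T⁴-continuum cell (rung (B)+1 on a FINITE torus only; NOT infinite volume, NOT the
mass gap, NOT the Clay statement; NOT a proof of the spine estimate NE7b, which is the cell's OWN estimate, NOT PRINTED
and NOT PROVED).  [folklore] over brick 3b (`RunInputM.junction_pedM` and its seven parts) and leaf-03∕08's IR-41-4
carrier `HistoryRealiseWeakCells.RealisedDomainsRW`; nothing printed is asserted, no `def … : Prop` fact of Bałaban's,
zero `sorry`.

WHY.  The END's domain carrier quantifies over cutoffs `K ≥ K₀` and terms `τ ∈ T K` with ONE flow (`L`, exponents
`s K`, sizes `R K` per cutoff).  M2 (operator side, brick B — the residual READING) is to supply, per term, the input of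
print's process: new regions `N`, classes `cls`, new-field cubes `F`, and the readiness memory `Rm K` of the run.
THIS FILE fixes that interface as DATA — **`InputFamily`** (common flow + per-term inputs), `InputFamily.run K τ :
RunInputM d`, payload map `id` — and proves **`realisedDomainsRW_of_family`**: under the displayed per-term conditions `NewOK`
((G-new)), memory domination `Rm K t k ≤ R K t` (print's current memory for non-increasing `R`), «no fresh clusters»
(located open point G-M4-1) and the box condition, the family's pedigrees∕live sets∕last-event domains form a
`RealisedDomainsRW` — so every END over that carrier (S12-W) applies to the process BY NAME, and what remains displayed
of H3^NE7b on this side is the identification of M2's term family with such an input family.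

HONEST.  Proves nothing of Bałaban's; M2 brick B not here; NE7b NOT proved; spine 0∕9.  HONEST DEPENDENCY (cell):
continuum YM on T⁴ ⇐ BetaPertH ∧ nine spine estimates (0/9 proved); BetaPertH ⇐ (D1) ∧ (D4) ∧ CAP+tail; G-an2-4 gates
asym, D1 and NE2/3/4.  This file changes none of it. -/

open Finset
open Literature.MathematicalPhysics.QuantumFieldTheory.Balaban1983to89
open Literature.MathematicalPhysics.QuantumFieldTheory.Balaban1983to89.B13ScaleTransfer
open Summit.QuantumFields.BalabanUV.T4Continuum.HistoryAdmissible
open Summit.QuantumFields.BalabanUV.T4Continuum.HistoryRealise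
open Summit.QuantumFields.BalabanUV.T4Continuum.HistoryRealisePrint
open Summit.QuantumFields.BalabanUV.T4Continuum.HistoryRealiseWeak
open Summit.QuantumFields.BalabanUV.T4Continuum.HistoryRealiseCells
open Summit.QuantumFields.BalabanUV.T4Continuum.HistoryRealiseWeakCells
open Summit.QuantumFields.BalabanUV.T4Continuum.HistoryZones
open Summit.QuantumFields.BalabanUV.T4Continuum.HistoryGen
open Summit.QuantumFields.BalabanUV.T4Continuum.HistoryGenealogyRealise
open Summit.QuantumFields.BalabanUV.T4Continuum.HistoryGenealogyPedigree

namespace Summit.QuantumFields.BalabanUV.T4Continuum.HistoryGenealogyInstantiate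

noncomputable section

variable {d : ℕ} {ι : Type*}

/-- **A TERM-INDEXED FAMILY OF INPUTS WITH A COMMON FLOW**: blocking parameter `L`, exponents `s K` and sizes `R K` of
the run with cutoff `K`, its readiness memory `Rm K`; per cutoff and term the new regions, classes and new-field cubes
(the data M2 brick B is to read off the admissible sequences of (1.72)). [folklore] -/
structure InputFamily (d : ℕ) (ι : Type*) where
  /-- blocking parameter -/
  L : ℕ
  /-- size exponents of the run with cutoff `K` -/
  s : ℕ → ℕ → ℕ
  /-- sizes `R_j` of the run with cutoff `K` -/
  R : ℕ → ℕ → ℕ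
  /-- readiness memory of the run with cutoff `K` -/
  Rm : ℕ → ℕ → ℕ → ℕ
  /-- new regions of term `τ` at cutoff `K`, per level -/
  N : ℕ → ι → ℕ → Finset (Lab d)
  /-- classes of the new regions -/
  cls : ℕ → ι → Lab d → ℕ
  /-- new-field cubes of term `τ` at cutoff `K`, per level -/
  F : ℕ → ι → ℕ → Finset (Pt d)

namespace InputFamily

variable (Φ : InputFamily d ι)

/-- the input of print's process for term `τ` at cutoff `K` [folklore] -/
abbrev run (K : ℕ) (τ : ι) : RunInputM d :=
  { L := Φ.L, s := Φ.s K, R := Φ.R K, N := Φ.N K τ, cls := Φ.cls K τ, F := Φ.F K τ, Rm := Φ.Rm K }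

/-- the family's pedigrees [folklore] -/
abbrev ped (K : ℕ) (τ : ι) : Pedigree (ℕ × Lab d) (Lab d) := (Φ.run K τ).pedM

/-- the family's live sets: the NAMES `(K, c)` of the components of the process at the cutoff [folklore] -/
abbrev liveC (K : ℕ) (τ : ι) : Finset (ℕ × Lab d) := ((Φ.run K τ).histM.comp K).image (Prod.mk K)

/-- the family's last-event domains, by name [folklore] -/
abbrev Z (K : ℕ) (τ : ι) (a : ℕ × Lab d) : Finset (Pt d) := (Φ.run K τ).ZM a.1 a.2

/-- a live name is `(K, c)` for a live component `c` [folklore] -/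
theorem mem_liveC_iff {K : ℕ} {τ : ι} {a : ℕ × Lab d} :
    a ∈ Φ.liveC K τ ↔ a.1 = K ∧ a.2 ∈ (Φ.run K τ).histM.comp K := by
  constructor
  · intro h
    obtain ⟨c, hc, rfl⟩ := Finset.mem_image.1 h
    exact ⟨rfl, hc⟩
  · rintro ⟨h1, h2⟩
    exact Finset.mem_image.2 ⟨a.2, h2, by rw [← h1]⟩

/-- **THE JUNCTION, PACKAGED.**  Under the displayed per-term conditions, the family's data form the END's
memory-agnostic domain carrier `RealisedDomainsRW`. [folklore] -/
theorem realisedDomainsRW_of_family (T : ℕ → Finset ι) (n K₀ : ℕ)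
    (hN : ∀ K, K₀ ≤ K → ∀ τ ∈ T K, (Φ.run K τ).NewOK)
    (hRm : ∀ K, K₀ ≤ K → ∀ τ ∈ T K, ∀ t k, (Φ.run K τ).Rm t k ≤ (Φ.run K τ).R t)
    (hNF : ∀ K, K₀ ≤ K → ∀ τ ∈ T K, NoFreshClusters (Φ.run K τ).histM)
    (hbox : ∀ K, K₀ ≤ K → ∀ τ ∈ T K, (Φ.run K τ).InBoxOK n K) :
    RealisedDomainsRW Φ.L Φ.s n K₀ Φ.R T Φ.ped (fun _ _ => id) Φ.liveC Φ.Z where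
  renew_step K _ τ _ c c' h := (Φ.run K τ).renew_step_pedM c c' h
  forest K hK τ hτ c := (Φ.run K τ).forest_pedM (hN K hK τ hτ) (hRm K hK τ hτ) c
  headOldest K hK τ hτ c := (Φ.run K τ).headOldest_pedM (hN K hK τ hτ) (hRm K hK τ hτ) (hNF K hK τ hτ) c
  real K hK τ hτ a ha := by
    obtain ⟨c, hc, rfl⟩ := Finset.mem_image.1 ha
    exact (Φ.run K τ).real_pedM (hN K hK τ hτ) (hRm K hK τ hτ) hc
  track K hK τ hτ a ha := by
    obtain ⟨c, hc, rfl⟩ := Finset.mem_image.1 ha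
    exact (Φ.run K τ).track_pedM (hN K hK τ hτ) (hRm K hK τ hτ) hc
  disjoint K hK τ hτ a ha a' ha' hne := by
    obtain ⟨c, hc, rfl⟩ := Finset.mem_image.1 ha
    obtain ⟨c', hc', rfl⟩ := Finset.mem_image.1 ha'
    have hne' : c ≠ c' := fun h => hne (by rw [h])
    exact (Φ.run K τ).disjoint_pedM (hN K hK τ hτ) (hRm K hK τ hτ) hc hc' hne'
  inBox K hK τ hτ a ha i := by
    obtain ⟨c, hc, rfl⟩ := Finset.mem_image.1 ha
    exact (Φ.run K τ).inBox_pedM (hN K hK τ hτ) (hRm K hK τ hτ) (hbox K hK τ hτ) hc i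

end InputFamily

end

end Summit.QuantumFields.BalabanUV.T4Continuum.HistoryGenealogyInstantiate
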